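import Mathlib.CategoryTheory.Sites.EpiMono
import Mathlib.CategoryTheory.Sites.Limits
import Mathlib.CategoryTheory.Abelian.Exact
import Mathlib.Algebra.Homology.ShortComplex.ExactFunctor
import Mathlib.CategoryTheory.Adjunction.Additive
import Mathlib.CategoryTheory.Adjunction.Limits
import Mathlib.CategoryTheory.Functor.Flat
import Mathlib.CategoryTheory.Limits.FilteredColimitCommutesFiniteLimit
import Mathlib.Algebra.Category.Grp.FilteredColimits
import Literature.AlgebraicGeometry.Motives.EtaleToProet
import Literature.Algebra.Homology.ExtComparison
import HarnessLib

/-!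
# Bhatt–Scholze Cor. 5.1.6 decomposed: `ν*` is exact (proved); `ν*` fully faithful and
# injectives acyclic ⇒ `Hⁱ(X_ét, F) ≅ Hⁱ(X_proét, ν*F)`

`EtaleToProet.lean` reduced the pro-étale/étale comparison (and the finiteness fact
`finite_proetCohomology_zmod_of_isProper`) to `nonempty_addEquiv_sheafH_etaleToProetPullback` —
Bhatt–Scholze Cor. 5.1.6 as `Hⁱ(X_ét, F) ≅ Hⁱ(X_proét, ν*(ulift F))`. Its printed proof has a
formal skeleton (dimension shifting,
`Literature.Algebra.Homology.mapExt_bijective_of_subsingleton_ext_obj_injective`) and three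
inputs, which this file separates:

* (a) **`ν*` is fully faithful** on abelian sheaves (Cor. 5.1.9, `i = 0`; Lemma 5.1.2 for sheaves
  of sets) — named fact `full_faithful_etaleToProetPullback`;
* (b) **`ν*` is exact** (inverse image of the morphism of topoi `ν`, §5; Mac Lane–Moerdijk
  VII.10 Thm. 2) — **proved here** (`preservesFiniteLimits_etaleToProetPullback`:
  `ν* = sheafify ∘ Lan`, the left Kan extension along the flat `etaleToProet` is a filtered
  colimit pointwise, filtered colimits commute with finite limits in `Ab` — also over the large
  index categories occurring here, via an equivalent small category — and sheafification is left
  exact; `ν*` is right exact as a left adjoint);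
* (c) **`Hᵖ(X_proét, ν*I) = 0` for `I` injective and `p > 0`** (the Čech computation in the proof
  of Cor. 5.1.6; also a consequence of its statement `I ≃ Rν_*ν*I`) — *not* a named fact: it is
  the residual proof obligation of Cor. 5.1.6 itself and enters the assembly as the explicit
  hypothesis `hc` (see the design notes; it was briefly the named fact
  `subsingleton_sheafH_etaleToProetPullback_injective`, merged back into Cor. 5.1.6 under D-0026);

and **proves** `(a) ∧ (c) ⇒ nonempty_addEquiv_sheafH_etaleToProetPullback`
(`nonempty_addEquiv_sheafH_etaleToProetPullback_of_facts`; with `(a)` as instances the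
isomorphism is canonical, `sheafHEquivEtaleToProetPullback`) and, conversely, Cor. 5.1.6 ⇒ (c)
(`subsingleton_sheafH_etaleToProetPullbackULift_of_pullback`: `Ext` into an injective object
vanishes in positive degrees), so that (c) and Cor. 5.1.6 are one proof obligation, not two. Also
proved: the change of
coefficient universe `ulift : Shv(X_ét, Ab.{u}) → Shv(X_ét, Ab.{u+1})` is additive, fully faithful
and exact (it preserves epimorphisms = locally surjective morphisms); `ν*` is additive and right
exact; `ν*(ulift ℤ_X) ≅ ℤ_X` (`pullbackConstantSheafIso` and Milne II 2.18 (a) twice).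

## References

* B. Bhatt, P. Scholze, *The pro-étale topology for schemes*, Astérisque 369 (2015)
  (arXiv:1309.1198): §5, Lemma 5.1.1, Lemma 5.1.2 ("The pullback `ν*` is fully faithful"),
  Cor. 5.1.6 and its proof ("it suffices to prove `Hᵖ(U, ν*I) = 0` for `I ∈ Ab(X_ét)` injective,
  `p > 0`"), Cor. 5.1.9 (dimension shifting). [BhattScholze2015]
* S. Mac Lane, I. Moerdijk, *Sheaves in geometry and logic*, Springer (1992): VII.10, Theorem 2
  (held copy p. 437: a morphism of sites — preserving finite limits and covers — "induces a
  geometric morphism `f : Sh(D, K) → Sh(C, J)`" with `f_* F = F ∘ φ`). [MaclaneMoerdijk1992]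

## Design notes

* `uliftEtSheaf X` and `etaleToProetPullbackULift X = uliftEtSheaf X ⋙ ν*` ("`ν*` on
  `Ab.{u}`-valued sheaves") are this file's functors; instances are declared on them and on the
  functors of `EtaleToProet.lean`, never on bare Mathlib carriers.
* (a) (`Functor.Full`/`Faithful`, propositions) is stated for `ν*` on `Ab.{u+1}`-valued sheaves
  and assumed as instances in the canonical construction; (c) is stated for `ulift I`, `I`
  injective in `Shv(X_ét, Ab.{u})` (enough injectives: Grothendieck abelian), which is what the
  dimension shifting consumes; the printed Čech argument is insensitive to the coefficient universe.
* Why (c) is a hypothesis and not a named fact (D-0026 review, 2026-08-15). As a statement it is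
  global — `Hᵖ⁺¹(X_proét, ν*I) = 0` for *every* scheme `X` — i.e. the printed affine claim
  "`Hᵖ(U, ν*I) = 0` for `U ∈ X_proét^aff`" together with the local-to-global half of the printed
  proof ("the first part follows from the second part by checking it on sections using
  Lemma 4.2.4"); modulo the glue proved in this cluster it is *equivalent* to Cor. 5.1.6
  (`…_of_facts` here with `full_faithful_etaleToProetPullback_holds`, and `…_of_pullback` below),
  so a separate named fact would count one published result twice. What its proof needs beyond the
  tree is a theory, not a lemma: (i) Čech cohomology of abelian presheaves for covering families
  and Cartan's criterion ("[SGA72b, Proposition V.4.3]" in the printed proof) comparing it with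
  `Sheaf.H` / `Sheaf.cohomologyPresheaf` (Mathlib has only `cechComplexFunctor`);
  (ii) Čech-acyclicity of injective abelian sheaves;
  (iii) Bhatt–Scholze Thm. 2.3.4 (a weakly étale `A → B` admits a faithfully flat ind-étale `B → C`
  with `A → C` ind-étale; Olivier's Thm. 2.3.5 and the w-strictly local extensions of §2.2), giving
  the cofinal ind-étale covers of a pro-étale affine — nothing of it is in Mathlib; (iv) the
  local-to-global passage (`Rν_*`, Leray). None of (i)–(iv) is bypassed by the point-set arguments
  that proved Lemma 5.1.1 in `EtaleToProetLanProofs.lean`.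
* Mathlib searches: exactness of `Functor.sheafPullback`/`Functor.lan` exists only for small sites
  (`lan_preservesFiniteLimits_of_flat`; its auxiliary `lanEvaluationIsoColim` is re-derived here in
  general universes); `Functor.Final.colimIso`, `AsSmall.equiv`; no exactness instances for
  `sheafCompose _ uliftFunctor`. Nothing restated.
-/

universe w u

open CategoryTheory Limits Opposite AlgebraicGeometry

noncomputable section

namespace Literature.AlgebraicGeometry.Motives

/-! ### Transport of `Ext` along an isomorphism of the source -/

/-- `Extⁿ(X', Y) ≃+ Extⁿ(X, Y)` for `e : X ≅ X'` (precomposition with `e.hom`, inverse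
precomposition with `e.inv`; Mathlib `Ext.precomp`, `Ext.mk₀_comp_mk₀_assoc`). [folklore] -/
def extAddEquivOfIsoLeft {C : Type*} [Category C] [Abelian C] [HasExt.{w} C] {X X' Y : C}
    (e : X ≅ X') (n : ℕ) : Abelian.Ext X' Y n ≃+ Abelian.Ext X Y n where
  toFun := (Abelian.Ext.mk₀ e.hom).precomp Y (zero_add n)
  invFun := (Abelian.Ext.mk₀ e.inv).precomp Y (zero_add n)
  left_inv α := by simp
  right_inv α := by simp
  map_add' := map_add _

/-! ### Change of coefficient universe on the étale site is exact -/

section ULift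

variable (X : Scheme.{u})

/-- `ulift : Shv(X_ét, Ab.{u}) ⥤ Shv(X_ét, Ab.{u+1})`, composition with
`AddCommGrpCat.uliftFunctor` (Mathlib `sheafCompose`). [folklore] -/
def uliftEtSheaf : Sheaf X.smallEtaleTopology Ab.{u} ⥤ Sheaf X.smallEtaleTopology Ab.{u + 1} :=
  sheafCompose X.smallEtaleTopology AddCommGrpCat.uliftFunctor.{u + 1, u}

/-- `ulift` is faithful. [folklore] -/
instance faithful_uliftEtSheaf : (uliftEtSheaf X).Faithful :=
  inferInstanceAs (sheafCompose X.smallEtaleTopology AddCommGrpCat.uliftFunctor.{u + 1, u}).Faithful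

/-- `ulift` is full. [folklore] -/
instance full_uliftEtSheaf : (uliftEtSheaf X).Full :=
  inferInstanceAs (sheafCompose X.smallEtaleTopology AddCommGrpCat.uliftFunctor.{u + 1, u}).Full

/-- `ulift` is additive (objectwise `ULift.up` is additive). [folklore] -/
instance additive_uliftEtSheaf : (uliftEtSheaf X).Additive where
  map_add {F G f g} := by
    ext U x
    rfl

/-- `ulift` is left exact: limits of sheaves are computed on underlying presheaves
(`sheafToPresheaf` creates them), where `uliftFunctor` preserves limits objectwise. [folklore] -/
instance preservesFiniteLimits_uliftEtSheaf : PreservesFiniteLimits (uliftEtSheaf X) := by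
  constructor
  intro K _ _
  haveI : PreservesLimitsOfShape K (uliftEtSheaf X ⋙ sheafToPresheaf _ _) :=
    inferInstanceAs (PreservesLimitsOfShape K (sheafToPresheaf X.smallEtaleTopology Ab.{u} ⋙
      (Functor.whiskeringRight (X.Etale)ᵒᵖ Ab.{u} Ab.{u + 1}).obj
        AddCommGrpCat.uliftFunctor.{u + 1, u}))
  exact preservesLimitsOfShape_of_reflects_of_preserves _ (sheafToPresheaf _ _)

/-- A locally surjective morphism of abelian presheaves stays locally surjective after
`uliftFunctor` (the image sieves are literally the same). [folklore] -/
theorem isLocallySurjective_whiskerRight_uliftFunctor {F G : (X.Etale)ᵒᵖ ⥤ Ab.{u}} (φ : F ⟶ G)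
    [Presheaf.IsLocallySurjective X.smallEtaleTopology φ] :
    Presheaf.IsLocallySurjective X.smallEtaleTopology
      (Functor.whiskerRight φ AddCommGrpCat.uliftFunctor.{u + 1, u}) where
  imageSieve_mem {U} s := by
    refine GrothendieckTopology.superset_covering _ ?_
      (Presheaf.imageSieve_mem X.smallEtaleTopology φ s.down)
    rintro V f ⟨t, ht⟩
    exact ⟨ULift.up t, congrArg ULift.up ht⟩

/-- `ulift` preserves epimorphisms: epimorphisms of abelian étale sheaves are the locally
surjective morphisms (Mathlib `Sheaf.isLocallySurjective_iff_epi'`), in either universe.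
[folklore] -/
instance preservesEpimorphisms_uliftEtSheaf : (uliftEtSheaf X).PreservesEpimorphisms where
  preserves {F G} φ hφ := by
    haveI : Sheaf.IsLocallySurjective φ :=
      (Sheaf.isLocallySurjective_iff_epi' AddCommGrpCat.{u} φ).2 hφ
    haveI : Presheaf.IsLocallySurjective X.smallEtaleTopology φ.hom := this
    haveI : Sheaf.IsLocallySurjective ((uliftEtSheaf X).map φ) :=
      isLocallySurjective_whiskerRight_uliftFunctor X φ.hom
    exact (Sheaf.isLocallySurjective_iff_epi' AddCommGrpCat.{u + 1} ((uliftEtSheaf X).map φ)).1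
      this

/-- `ulift` is right exact (an additive left exact functor preserving epimorphisms preserves
homology, Mathlib `Functor.preservesHomology_of_preservesEpis_and_kernels`). [folklore] -/
instance preservesFiniteColimits_uliftEtSheaf : PreservesFiniteColimits (uliftEtSheaf X) := by
  haveI : (uliftEtSheaf X).PreservesHomology :=
    (uliftEtSheaf X).preservesHomology_of_preservesEpis_and_kernels
  exact (uliftEtSheaf X).preservesFiniteColimits_of_preservesHomology

end ULift

/-! ### `ν_*` additive, `ν*` additive and right exact; `ν*` on `Ab.{u}`-valued sheaves -/

section Nu

variable (X : Scheme.{u})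

/-- `ν_*` (restriction) is additive. [folklore] -/
instance additive_proetToEtalePushforward :
    (proetToEtalePushforward X Ab.{u + 1}).Additive where
  map_add {F G f g} := by
    ext U x
    rfl

/-- `ν*` is additive (left adjoint of the additive `ν_*`). [folklore] -/
instance additive_etaleToProetPullback : (etaleToProetPullback X).Additive :=
  (etaleToProetAdjunction X).left_adjoint_additive

/-- `ν*` preserves colimits (it is a left adjoint). [folklore] -/
instance preservesColimitsOfSize_etaleToProetPullback :
    PreservesColimitsOfSize.{u, u + 1} (etaleToProetPullback X) :=
  (etaleToProetAdjunction X).leftAdjoint_preservesColimits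

/-- `ν*` is right exact. [folklore] -/
instance preservesFiniteColimits_etaleToProetPullback :
    PreservesFiniteColimits (etaleToProetPullback X) :=
  PreservesColimitsOfSize.preservesFiniteColimits _

/-- **`ν*` on `Ab.{u}`-valued étale sheaves**: lift coefficients to `Ab.{u+1}`, then pull back to
`X_proét` (the functor whose cohomological behaviour `nonempty_addEquiv_sheafH_etaleToProetPullback`
describes). [cite: BhattScholze2015, §5] -/
abbrev etaleToProetPullbackULift :
    Sheaf X.smallEtaleTopology Ab.{u} ⥤ Sheaf (Scheme.ProEt.topology X) Ab.{u + 1} :=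
  uliftEtSheaf X ⋙ etaleToProetPullback X

/-- **`ν*` of the constant étale sheaf `M` (coefficients in `Ab.{u}`) is the constant pro-étale
sheaf `M`**, canonically: `ulift(M_X^{ét,u}) ≅ ulift(U ↦ C(U, M)) ≅ M_X^{ét,u+1}` for the discrete
topology on `M` (Milne II 2.18 (a) in both universes, `constantSheafIsoContinuousMapEtSheaf`,
`constantSheafULiftIsoContinuousMapEtSheaf`), then `ν*(M_X^{ét}) ≅ M_X^{proét}`
(`pullbackConstantSheafIso`). [cite: BhattScholze2015, Lemma 4.2.12 and Cor. 5.1.9]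
[cite: Milne2025, II Examples 2.18 (a)] -/
def etaleToProetPullbackULiftConstantIso (M : Type) [AddCommGroup M] :
    (etaleToProetPullbackULift X).obj
        ((constantSheaf X.smallEtaleTopology Ab.{u}).obj (AddCommGrpCat.of (ULift.{u} M))) ≅
      (constantSheaf (Scheme.ProEt.topology X) Ab.{u + 1}).obj
        (AddCommGrpCat.of (ULift.{u + 1} M)) :=
  letI : TopologicalSpace M := ⊥
  haveI : DiscreteTopology M := ⟨rfl⟩
  (etaleToProetPullback X).mapIso
      ((sheafCompose X.smallEtaleTopology AddCommGrpCat.uliftFunctor.{u + 1, u}).mapIso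
          (constantSheafIsoContinuousMapEtSheaf X M) ≪≫
        (constantSheafULiftIsoContinuousMapEtSheaf X M).symm) ≪≫
    (pullbackConstantSheafIso X).app (AddCommGrpCat.of (ULift.{u + 1} M))

end Nu

/-! ### `ν*` is left exact (Mac Lane–Moerdijk VII.10 Thm. 2 for `etaleToProet`) -/

section LeftExact

-- The next definition is Mathlib's `lanEvaluationIsoColim` (Functor/Flat.lean) with its universe
-- restrictions lifted; the proof is copied verbatim and needs the same two technical options
-- Mathlib sets for it (they only affect elaboration of this declaration).
set_option backward.defeqAttrib.useBackward true in
set_option backward.isDefEq.respectTransparency false in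
/-- Mathlib's `lanEvaluationIsoColim` in general universes: the left Kan extension along `F`,
evaluated at `Y`, is the colimit over the costructured arrows `CostructuredArrow F Y` (pointwise
left Kan extension; the proof is Mathlib's, verbatim). [folklore] -/
def lanEvaluationIsoColim {C : Type*} [Category C] {D : Type*} [Category D] (E : Type*)
    [Category E] (F : C ⥤ D) (Y : D) [∀ Y : D, HasColimitsOfShape (CostructuredArrow F Y) E]
    [∀ G : C ⥤ E, F.HasLeftKanExtension G] :
    F.lan ⋙ (evaluation D E).obj Y ≅
      (Functor.whiskeringLeft _ _ E).obj (CostructuredArrow.proj F Y) ⋙ colim :=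
  NatIso.ofComponents (fun G =>
    IsColimit.coconePointUniqueUpToIso
    (Functor.isPointwiseLeftKanExtensionLeftKanExtensionUnit F G Y)
    (colimit.isColimit _)) (fun {G₁ G₂} φ => by
      apply (Functor.isPointwiseLeftKanExtensionLeftKanExtensionUnit F G₁ Y).hom_ext
      intro T
      have h₁ := fun (G : C ⥤ E) => IsColimit.comp_coconePointUniqueUpToIso_hom
        (Functor.isPointwiseLeftKanExtensionLeftKanExtensionUnit F G Y) (colimit.isColimit _) T
      have h₂ := congr_app (F.lanUnit.naturality φ) T.left
      dsimp at h₁ h₂ ⊢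
      simp only [Category.assoc] at h₁ ⊢
      simp only [Functor.lan, Functor.lanUnit] at h₂ ⊢
      rw [reassoc_of% h₁, NatTrans.naturality_assoc, ← reassoc_of% h₂, h₁,
        ι_colimMap, Functor.whiskerLeft_app]
      rfl)

/-- Filtered colimits commute with finite limits in `Ab.{u+1}` also over a *large* filtered index
category `K` (objects in `Type (u+1)`, morphisms in `Type u`, as for the categories of
costructured arrows of `etaleToProet`): transport Mathlib's instance for the equivalent small
category `AsSmall K` along `Functor.Final.colimIso`. [folklore] -/
theorem colim_preservesFiniteLimits_of_isFiltered (K : Type (u + 1)) [Category.{u} K]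
    [IsFiltered K] : PreservesFiniteLimits (colim : (K ⥤ Ab.{u + 1}) ⥤ Ab.{u + 1}) := by
  haveI : IsFiltered (AsSmall.{u + 1} K) := IsFiltered.of_equivalence AsSmall.equiv
  let e : K ≌ AsSmall.{u + 1} K := AsSmall.equiv
  haveI : PreservesFiniteLimits ((Functor.whiskeringLeft (AsSmall.{u + 1} K) K Ab.{u + 1}).obj
      e.inverse ⋙ (colim : (AsSmall.{u + 1} K ⥤ Ab.{u + 1}) ⥤ Ab.{u + 1})) := by
    constructor
    intro J _ _
    infer_instance
  exact preservesFiniteLimits_of_natIso (Functor.Final.colimIso e.inverse)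

variable (X : Scheme.{u})

/-- The categories of costructured arrows of the flat functor `etaleToProet X` are filtered
(Mathlib `structuredArrowOpEquivalence`). [folklore] -/
instance isFiltered_costructuredArrow_etaleToProet (K : (X.ProEt)ᵒᵖ) :
    IsFiltered (CostructuredArrow (etaleToProet X).op K) :=
  IsFiltered.of_equivalence (structuredArrowOpEquivalence (etaleToProet X) (unop K))

/-- The left Kan extension of abelian presheaves along `etaleToProet X` is left exact (pointwise
it is a filtered colimit; cf. Mathlib `lan_preservesFiniteLimits_of_flat` for small categories).
[cite: MaclaneMoerdijk1992, VII.10 Thm. 2] -/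
instance lan_preservesFiniteLimits_etaleToProet :
    PreservesFiniteLimits ((etaleToProet X).op.lan :
      ((X.Etale)ᵒᵖ ⥤ Ab.{u + 1}) ⥤ (X.ProEt)ᵒᵖ ⥤ Ab.{u + 1}) := by
  constructor
  intro J _ _
  apply preservesLimitsOfShape_of_evaluation
  intro K
  haveI := colim_preservesFiniteLimits_of_isFiltered (CostructuredArrow (etaleToProet X).op K)
  exact preservesLimitsOfShape_of_natIso
    (lanEvaluationIsoColim Ab.{u + 1} (etaleToProet X).op K).symm

/-- **`ν*` is left exact, proved.** Bhatt–Scholze §5: `ν : Shv(X_proét) → Shv(X_ét)` is a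
morphism of topoi, so its inverse image `ν*` is exact; the general statement is Mac Lane–Moerdijk
VII.10 Theorem 2 (held copy p. 437): a functor `φ : C → D` between sites with finite limits which
preserves finite limits and covers — here `etaleToProet X`, `preservesFiniteLimits_etaleToProet`,
`coverPreserving_etaleToProet` — "induces a geometric morphism `f : Sh(D, K) → Sh(C, J)`" with
`f_* F = F ∘ φ` (so `f* ⊣ f_*` is `etaleToProetAdjunction` and `f* = ν*`). Real proof on Mathlib's
carriers: `ν* ≅ sheafification ∘ Lan` (Mathlib `sheafPullbackConstruction`), `Lan` is left exact
(`lan_preservesFiniteLimits_etaleToProet`) and so is sheafification (`HasSheafify`).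
[cite: MaclaneMoerdijk1992, VII.10 Thm. 2] [cite: BhattScholze2015, §5] -/
instance preservesFiniteLimits_etaleToProetPullback :
    PreservesFiniteLimits (etaleToProetPullback X) :=
  inferInstance

end LeftExact

/-! ### Input (a) of Bhatt–Scholze Cor. 5.1.6 as a named fact -/

/-- **`ν*` is fully faithful on abelian sheaves — Bhatt–Scholze Cor. 5.1.9 for `i = 0`, resp.
Lemma 5.1.2** (named fact, statement only). Cor. 5.1.9: "The pullback `ν* : Ab(X_ét) → Ab(X_proét)`
induces an equivalence on `Extⁱ` for all `i`"; for `i = 0` this says that `ν*` is bijective on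
`Hom`, i.e. fully faithful. (For sheaves of sets this is Lemma 5.1.2, "The pullback
`ν* : Shv(X_ét) → Shv(X_proét)` is fully faithful", from Lemma 5.1.1, `ν*F(U) = colim_i F(U_i)`,
which gives `F ≃ ν_*ν*F`; the printed proofs rest on the ind-étale presentation of affine weakly
étale maps, Thm. 2.3.4, not in Mathlib.) Read on Mathlib's carriers: `ν* = etaleToProetPullback X`
(`Functor.sheafPullback` along `etaleToProet X`) on `Ab.{u+1}`-valued sheaves, `X.ProEt` without
cardinal cut-off (Remark 4.1.2). Discharged downstream: `full_faithful_etaleToProetPullback_holds`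
(`EtaleToProetLanProofs.lean`, via Lemma 5.1.1 proved on Mathlib's carriers).
[cite: BhattScholze2015, Cor. 5.1.9 and Lemma 5.1.2] -/
def full_faithful_etaleToProetPullback : Prop :=
  ∀ (X : Scheme.{u}), (etaleToProetPullback X).Full ∧ (etaleToProetPullback X).Faithful


/-! ### The assembly: (a) ∧ (b) ∧ (c) ⇒ Cor. 5.1.6, and Cor. 5.1.6 ⇒ (c) -/

section Assembly

variable (X : Scheme.{u})

/-- **The acyclicity hypothesis (c) and its first use.** `hc` — here and in every assembly
below — reads: for every scheme `X`, every injective `I` of `Shv(X_ét, Ab.{u})` and every `p`,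
`Hᵖ⁺¹(X_proét, ν*I) = 0`, with `ν*I := etaleToProetPullbackULift X I = ν*(ulift I)` and
`Hᵖ = Sheaf.H = Extᵖ(ℤ_X, –)` on `X.ProEt` (`Ab.{u+1}`, no cardinal cut-off, Remark 4.1.2). It is
the heart of the printed proof of Bhatt–Scholze Cor. 5.1.6 ("it suffices to prove:
`Hᵖ(U, ν*I) = 0` for `I ∈ Ab(X_ét)` injective, `p > 0`, and `U ∈ X_proét^{aff}`. By [SGA4,
Proposition V.4.3], it suffices to prove that `Ȟᵖ(U, ν*I) = 0`", computed as a filtered colimit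
of Čech complexes of affine étale covers of the `U_i` in a presentation `U = lim U_i`, Thm. 2.3.4
and Lemma 5.1.1, each acyclic since `I|_{U_i}` is injective) read globally, and equally a
consequence of the statement of Cor. 5.1.6 (`I ≃ Rν_*ν*I`;
`subsingleton_sheafH_etaleToProetPullbackULift_of_pullback`) — the residual proof obligation of
Cor. 5.1.6, kept as an explicit hypothesis (design notes). This lemma puts it in the form the
dimension shifting consumes: `Extᵖ⁺¹(ν*ℤ_X, ν*I) = 0` (transport of
`Hᵖ⁺¹(X_proét, ν*I) = Extᵖ⁺¹(ℤ_X, ν*I)` along `ν*(ulift ℤ_X^{ét}) ≅ ℤ_X^{proét}`,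
`etaleToProetPullbackULiftConstantIso`). [cite: BhattScholze2015, Cor. 5.1.6 (proof)] -/
theorem subsingleton_ext_etaleToProetPullbackULift_of
    (hc : ∀ (X : Scheme.{u}) (I : Sheaf X.smallEtaleTopology Ab.{u}), Injective I →
      ∀ p : ℕ, Subsingleton (((etaleToProetPullbackULift X).obj I).H (p + 1)))
    (I : Sheaf X.smallEtaleTopology Ab.{u}) (hI : Injective I) (n : ℕ) :
    Subsingleton (Abelian.Ext.{u + 1}
      ((etaleToProetPullbackULift X).obj
        ((constantSheaf X.smallEtaleTopology Ab.{u}).obj (AddCommGrpCat.of (ULift.{u} ℤ))))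
      ((etaleToProetPullbackULift X).obj I) (n + 1)) :=
  haveI := hc X I hI n
  (extAddEquivOfIsoLeft (etaleToProetPullbackULiftConstantIso X ℤ)
    (n + 1)).symm.toEquiv.subsingleton

variable [(etaleToProetPullback X).Full] [(etaleToProetPullback X).Faithful]

/-- **The canonical comparison `Hⁱ(X_ét, F) ≃+ Hⁱ(X_proét, ν*F)` under (a) and (c)**: the
dimension-shifting `Ext`-comparison
(`Literature.Algebra.Homology.mapExtAddEquivOfSubsingletonExtObjInjective`) for the additive,
exact, fully faithful functor `ν* ∘ ulift : Shv(X_ét, Ab.{u}) → Shv(X_proét, Ab.{u+1})` and the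
source `ℤ_X` (`Hⁱ = Extⁱ(ℤ_X, –)`, Mathlib `Sheaf.H`), followed by the transport along
`ν*(ulift ℤ_X) ≅ ℤ_X`. This is Bhatt–Scholze's proof of Cor. 5.1.6 / Cor. 5.1.9 with its two
non-formal inputs as hypotheses (exactness of `ν*` being proved above).
[cite: BhattScholze2015, Cor. 5.1.6 and Cor. 5.1.9] -/
def sheafHEquivEtaleToProetPullback
    (hc : ∀ (X : Scheme.{u}) (I : Sheaf X.smallEtaleTopology Ab.{u}), Injective I →
      ∀ p : ℕ, Subsingleton (((etaleToProetPullbackULift X).obj I).H (p + 1)))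
    (F : Sheaf X.smallEtaleTopology Ab.{u}) (i : ℕ) :
    (F.H i : Type u) ≃+ ((etaleToProetPullbackULift X).obj F).H i :=
  (Literature.Algebra.Homology.mapExtAddEquivOfSubsingletonExtObjInjective
      (etaleToProetPullbackULift X)
      ((constantSheaf X.smallEtaleTopology Ab.{u}).obj (AddCommGrpCat.of (ULift.{u} ℤ)))
      (subsingleton_ext_etaleToProetPullbackULift_of X hc) F i).trans
    (extAddEquivOfIsoLeft (etaleToProetPullbackULiftConstantIso X ℤ) i).symm

end Assembly

/-- **Cor. 5.1.6 ⇒ (c): the acyclicity hypothesis is implied by the statement it serves.** If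
`Hⁱ(X_ét, F) ≃+ Hⁱ(X_proét, ν*F)` for all `F`, `i`
(`nonempty_addEquiv_sheafH_etaleToProetPullback`), then `Hᵖ⁺¹(X_proét, ν*I) = 0` for every
injective `I` of `Shv(X_ét, Ab.{u})`: transport along the
isomorphism for `F = I` and `Hᵖ⁺¹(X_ét, I) = Extᵖ⁺¹(ℤ_X, I) = 0` (Mathlib
`Abelian.Ext.subsingleton_of_injective`). With `nonempty_addEquiv_sheafH_etaleToProetPullback_of_facts`
and the proved Lemma 5.1.2 this makes (c) and Cor. 5.1.6 a single proof obligation (the printed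
`I ≃ Rν_*ν*I`, read on cohomology), which is why (c) is kept as a hypothesis and not vendored as
a named fact (D-0026). [cite: BhattScholze2015, Cor. 5.1.6] -/
theorem subsingleton_sheafH_etaleToProetPullbackULift_of_pullback
    (h : nonempty_addEquiv_sheafH_etaleToProetPullback.{u}) (X : Scheme.{u})
    (I : Sheaf X.smallEtaleTopology Ab.{u}) (hI : Injective I) (p : ℕ) :
    Subsingleton (((etaleToProetPullbackULift X).obj I).H (p + 1)) := by
  obtain ⟨e⟩ := h X I (p + 1)
  haveI : Subsingleton (I.H (p + 1)) := Abelian.Ext.subsingleton_of_injective _ _ _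
  exact e.symm.toEquiv.subsingleton

/-- **Bhatt–Scholze Cor. 5.1.6 from its two non-formal inputs**: if `ν*` is fully faithful
(Lemma 5.1.2, `ha`; discharged in `EtaleToProetLanProofs.lean`) and injective étale sheaves are
acyclic on `X_proét` (`hc`: "`Hᵖ(U, ν*I) = 0` for `I ∈ Ab(X_ét)` injective, `p > 0`", the printed
proof of Cor. 5.1.6, read globally — see `subsingleton_ext_etaleToProetPullbackULift_of`), then
`Hⁱ(X_ét, F) ≅ Hⁱ(X_proét, ν*F)` for every abelian étale sheaf `F`
(`nonempty_addEquiv_sheafH_etaleToProetPullback`); exactness of `ν*` is proved.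
[cite: BhattScholze2015, Cor. 5.1.6] -/
theorem nonempty_addEquiv_sheafH_etaleToProetPullback_of_facts
    (ha : full_faithful_etaleToProetPullback.{u})
    (hc : ∀ (X : Scheme.{u}) (I : Sheaf X.smallEtaleTopology Ab.{u}), Injective I →
      ∀ p : ℕ, Subsingleton (((etaleToProetPullbackULift X).obj I).H (p + 1))) :
    nonempty_addEquiv_sheafH_etaleToProetPullback.{u} := by
  intro X F i
  haveI := (ha X).1
  haveI := (ha X).2
  exact ⟨sheafHEquivEtaleToProetPullback X hc F i⟩

/-- Hence the constant-sheaf bridge, the bridge fact of `EllAdicCohomologyFinitenessEtale.lean`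
and — with Milne VI Cor. 2.8 on the étale site — **`finite_proetCohomology_zmod_of_isProper`
follow from (a) and (c)**; the trust base of the pro-étale finiteness fact is now
{`finite_etaleCohomology_of_isProper`, `full_faithful_etaleToProetPullback`, the acyclicity
hypothesis `hc` (the residual proof obligation of Cor. 5.1.6)}.
[cite: Milne2025, VI Cor. 2.8] [cite: BhattScholze2015, Cor. 5.1.6] -/
theorem finite_proetCohomology_zmod_of_isProper_of_etale_site_facts
    (h₂ : finite_etaleCohomology_of_isProper.{u})
    (ha : full_faithful_etaleToProetPullback.{u})
    (hc : ∀ (X : Scheme.{u}) (I : Sheaf X.smallEtaleTopology Ab.{u}), Injective I →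
      ∀ p : ℕ, Subsingleton (((etaleToProetPullbackULift X).obj I).H (p + 1))) :
    finite_proetCohomology_zmod_of_isProper.{u} :=
  finite_proetCohomology_zmod_of_isProper_of_pullback h₂
    (nonempty_addEquiv_sheafH_etaleToProetPullback_of_facts ha hc)

/-- The bridge fact `nonempty_addEquiv_proetCohomology_etaleCohomology` from (a) and (c).
[cite: BhattScholze2015, Cor. 5.1.6] -/
theorem nonempty_addEquiv_proetCohomology_etaleCohomology_of_etale_site_facts
    (ha : full_faithful_etaleToProetPullback.{u})
    (hc : ∀ (X : Scheme.{u}) (I : Sheaf X.smallEtaleTopology Ab.{u}), Injective I →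
      ∀ p : ℕ, Subsingleton (((etaleToProetPullbackULift X).obj I).H (p + 1))) :
    nonempty_addEquiv_proetCohomology_etaleCohomology.{u} :=
  nonempty_addEquiv_proetCohomology_etaleCohomology_of_pullback
    (nonempty_addEquiv_sheafH_etaleToProetPullback_of_facts ha hc)

end Literature.AlgebraicGeometry.Motives

end
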